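import Summits.CriticalPhenomena.PercolationContinuityZ3.Theorems.PercLowPointHalfSpaceQuantitativeBGNFloorDefs
import Summits.CriticalPhenomena.PercolationContinuityZ3.Theorems.PercLowPointHalfSpaceQuantitativeBGNFloorArmLocality
import Summits.CriticalPhenomena.PercolationContinuityZ3.Theorems.PercLowPointHalfSpaceQuantitativeBGNFloorDepthMono
import Summits.CriticalPhenomena.PercolationContinuityZ3.Theorems.PercLowPointHalfSpaceQuantitativeBGNFloorNoFloor
import Literature.Probability.Percolation.HalfSpaceFloorDilution
import Literature.Probability.Percolation.SharpnessDCTProofs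
import HarnessLib

/-!
# `QuantitativeBGN` (stmt-CriticalPhenomena-0913), line `microscopic-floor-doubling-gain` — exactness at `s = 0`

Crux `Summit.CriticalPhenomena.PercolationContinuityZ3.Theses.PercLowPointHalfSpace.QuantitativeBGN`
(item stmt-CriticalPhenomena-0913), line `microscopic-floor-doubling-gain`, stub
`armProbFloor_succ_zero` (exactness certificate, part 1).

Statement proved: `∀ r j, j + 1 ≠ r → armProbFloor r (j + 1) 0 = gammaR r j` — WITH THE FLOOR
DELETED (floor density `s = 0` in the floor-diluted half-space measure
`floorDilutedPercolation 3 p_c 0` of `Literature/Probability/Percolation/HalfSpaceFloorDilution.lean`),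
the probability `f_{j+1}(0)` of the depth-`(j+1)` arm event `armFrom r (j+1)` of
`Theorems/PercLowPointHalfSpaceQuantitativeBGNFloorDefs.lean` EQUALS the critical depth-`j` arm
probability `γ_r(j)`; this sharpens `stub_noFloor` (`γ_r(j) ≤ f_{j+1}(0)`,
`Theorems/PercLowPointHalfSpaceQuantitativeBGNFloorNoFloor.lean`) to an equality, valid except at
the single degenerate height `j + 1 = r`.

Proof (walk surgery at the pendant floor vertices).
* Under `P^{ℍ}_{p_c,0}` almost every configuration has all floor edges closed (their weight is
  `0 · p_c = 0`; `prodBernoulli_ae_forall_notMem`, `FloorSuccZero.ae_floor_closed`).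
* For such an `ω`, every floor vertex `(0,z)` has at most one open lattice edge inside `H`, the
  vertical one to `(1,z)`. Along an open `H`-walk of `ω ∩ E(ℤ³)` from `s = (j+1)·e₀` we carry the
  invariant "a vertex of height `≥ 1` is joined to `s` inside the strict upper region
  `{x₀ ≥ 1}`, and for a floor vertex `v` the point `v + e₀` is" (`FloorSuccZero.step`,
  `FloorSuccZero.pathIn_upper`). At the far endpoint `y` (sup-distance `≥ r` from `s`): if
  `y₀ ≥ 1` we are done; if `y` is on the floor we use `y + e₀`, which is still at sup-distance
  `≥ r` from `s` unless the far coordinate is the vertical one with `j < r ≤ j + 1`, i.e.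
  `j + 1 = r` — excluded (`FloorSuccZero.exists_far_pathIn_upper`).
* Shifting down by `e₀` (`DCT16.pathIn_map`, `FloorDepthMono.adj_shift_iff`), `ω` lies in
  `E₁ := (ω ↦ ω - e₀) ⁻¹' armFrom r j` (`FloorSuccZero.mem_preimage_shiftDown`). Together with
  `E₁ ⊆ armFrom r (j+1)` (`FloorNoFloor.preimage_shiftDown_subset_armFrom`) this gives
  `armFrom r (j+1) =ᵐ E₁` under `P^{ℍ}_{p_c,0}`, hence
  `f_{j+1}(0) = P^{ℍ}_{p_c,0}(E₁) = P_{p_c}(E₁) = γ_r(j)`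
  (`FloorNoFloor.floorDilutedPercolation_zero_real_eq`, `FloorNoFloor.real_preimage_shiftDown`).
-/

noncomputable section

namespace Summit.CriticalPhenomena.PercolationContinuityZ3.Theorems

open MeasureTheory Literature.Probability.Percolation Literature.Probability.LatticeModels
open FloorDoubling

namespace FloorSuccZero

/-- Under `P^{ℍ}_{p,0}` almost surely every floor edge is closed (its weight is `0 · p = 0`).
[folklore] -/
theorem ae_floor_closed (p : unitInterval) :
    ∀ᵐ ω ∂floorDilutedPercolation 3 p 0, ∀ e ∈ floorEdgeSet 3, e ∉ ω :=
  prodBernoulli_ae_forall_notMem (floorDilutedParam 3 p 0) (Set.to_countable _)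
    fun e he => by rw [floorDilutedParam_of_mem_floorEdgeSet p 0 he, zero_mul]

/-- Two lattice neighbours of `ℤ³` either differ by the vertical unit vector `e₀ = Pi.single 0 1`
(in one of the two directions) or have the same height `x₀`. [folklore] -/
theorem adj_trichotomy {a b : Site 3} (h : (zdGraph 3).Adj a b) :
    b = a + Pi.single 0 1 ∨ a = b + Pi.single 0 1 ∨ a 0 = b 0 := by
  obtain ⟨i, hi | hi⟩ := (zdGraph_adj_iff a b).1 h
  · by_cases hi0 : i = 0
    · subst hi0; exact Or.inl hi
    · refine Or.inr (Or.inr ?_)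
      rw [hi, Pi.add_apply, Pi.single_eq_of_ne' hi0, add_zero]
  · by_cases hi0 : i = 0
    · subst hi0; exact Or.inr (Or.inl hi)
    · refine Or.inr (Or.inr ?_)
      rw [hi, Pi.add_apply, Pi.single_eq_of_ne' hi0, add_zero]

/-- When every floor edge is closed, an open lattice edge has at most one endpoint on the floor
`{x₀ = 0}` (floor vertices are pendant). [folklore] -/
theorem not_floor_of_adj {ω : BondConfig (Site 3)} (hclosed : ∀ e ∈ floorEdgeSet 3, e ∉ ω)
    {a b : Site 3} (hab : (openGraph (ω ∩ (zdGraph 3).edgeSet)).Adj a b) (ha : a 0 = 0) :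
    b 0 ≠ 0 := by
  intro hb
  rw [openGraph_adj] at hab
  refine hclosed _ ⟨hab.1.2, fun z hz => ?_⟩ hab.1.1
  rcases Sym2.mem_iff.1 hz with rfl | rfl
  · exact ha
  · exact hb

/-- **The surgery step.** Let every floor edge be closed and let `G` be the open lattice graph of
`ω`. The invariant "a vertex `v` of height `≥ 1` is joined to `s` inside the strict upper region
`{x₀ ≥ 1}`, and for a floor vertex `v` the point `v + e₀` above it is" passes along every open
edge `a ∼ b` with `a ∈ H`: from height `≥ 1` one either stays at height `≥ 1` (extend the path) or
steps down vertically onto the floor (`a = b + e₀`); from a floor vertex the only open edge is the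
vertical one up (`b = a + e₀`). [folklore] -/
theorem step {ω : BondConfig (Site 3)} (hclosed : ∀ e ∈ floorEdgeSet 3, e ∉ ω) {s a b : Site 3}
    (ha : a ∈ {x : Site 3 | 0 ≤ x 0})
    (hPa : (1 ≤ a 0 → PathIn (openGraph (ω ∩ (zdGraph 3).edgeSet)) {x : Site 3 | 1 ≤ x 0} s a) ∧
      (a 0 = 0 → PathIn (openGraph (ω ∩ (zdGraph 3).edgeSet)) {x : Site 3 | 1 ≤ x 0} s
        (a + Pi.single 0 1)))
    (hab : (openGraph (ω ∩ (zdGraph 3).edgeSet)).Adj a b) :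
    (1 ≤ b 0 → PathIn (openGraph (ω ∩ (zdGraph 3).edgeSet)) {x : Site 3 | 1 ≤ x 0} s b) ∧
      (b 0 = 0 → PathIn (openGraph (ω ∩ (zdGraph 3).edgeSet)) {x : Site 3 | 1 ≤ x 0} s
        (b + Pi.single 0 1)) := by
  have hadj : (zdGraph 3).Adj a b := DCT16.adj_of_openGraph_adj Set.inter_subset_right hab
  have htri := adj_trichotomy hadj
  have he0 : (Pi.single 0 1 : Site 3) 0 = 1 := Pi.single_eq_same _ _
  simp only [Set.mem_setOf_eq] at ha
  by_cases ha1 : 1 ≤ a 0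
  · -- `a` at height `≥ 1`
    have hpa := hPa.1 ha1
    refine ⟨fun hb1 => hpa.tail hab hb1, fun hb0 => ?_⟩
    rcases htri with h | h | h
    · exfalso; rw [h, Pi.add_apply, he0] at hb0; omega
    · subst h; exact hpa
    · exfalso; omega
  · -- `a` on the floor: the open edge `a ∼ b` is the vertical one
    have ha0 : a 0 = 0 := by omega
    have hpa := hPa.2 ha0
    have hb0 : b 0 ≠ 0 := not_floor_of_adj hclosed hab ha0
    refine ⟨fun _ => ?_, fun hb0' => absurd hb0' hb0⟩
    rcases htri with h | h | h
    · subst h; exact hpa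
    · exfalso; rw [h, Pi.add_apply, he0] at ha0; omega
    · exfalso; omega

/-- **Walk surgery (the invariant along a whole walk).** If every floor edge is closed and `s` has
height `≥ 1`, then for every open `H`-walk of `ω ∩ E(ℤ³)` from `s` to `y`: if `y₀ ≥ 1` then `y`
is joined to `s` inside `{x₀ ≥ 1}`, and if `y₀ = 0` then `y + e₀` is (`DCT16.pathIn_induction`
with `step`). [folklore] -/
theorem pathIn_upper {ω : BondConfig (Site 3)} (hclosed : ∀ e ∈ floorEdgeSet 3, e ∉ ω)
    {s y : Site 3} (hs : 1 ≤ s 0)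
    (hpath : PathIn (openGraph (ω ∩ (zdGraph 3).edgeSet)) {x : Site 3 | 0 ≤ x 0} s y) :
    (1 ≤ y 0 → PathIn (openGraph (ω ∩ (zdGraph 3).edgeSet)) {x : Site 3 | 1 ≤ x 0} s y) ∧
      (y 0 = 0 → PathIn (openGraph (ω ∩ (zdGraph 3).edgeSet)) {x : Site 3 | 1 ≤ x 0} s
        (y + Pi.single 0 1)) :=
  DCT16.pathIn_induction
    (fun v => (1 ≤ v 0 → PathIn (openGraph (ω ∩ (zdGraph 3).edgeSet)) {x : Site 3 | 1 ≤ x 0} s v) ∧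
      (v 0 = 0 → PathIn (openGraph (ω ∩ (zdGraph 3).edgeSet)) {x : Site 3 | 1 ≤ x 0} s
        (v + Pi.single 0 1)))
    hpath ⟨fun _ => PathIn.refl hs, fun h0 => absurd h0 (by omega)⟩
    fun _ _ ha _ hPa hab => step hclosed ha hPa hab

/-- **End of the surgery.** If every floor edge is closed and `j + 1 ≠ r`, an open `H`-walk of
`ω ∩ E(ℤ³)` from `s = (j+1)·e₀` to a point at sup-distance `≥ r` from `s` yields an open walk
INSIDE `{x₀ ≥ 1}` from `s` to a point at sup-distance `≥ r` from `s`: the endpoint itself if it is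
off the floor, else the point above it — still far, because for the vertical coordinate
`|0 - (j+1)| ≥ r > j = |1 - (j+1)|` would force `j + 1 = r`. [folklore] -/
theorem exists_far_pathIn_upper {r j : ℕ} (hjr : j + 1 ≠ r) {ω : BondConfig (Site 3)}
    (hclosed : ∀ e ∈ floorEdgeSet 3, e ∉ ω) {y : Site 3}
    (hy : ∃ i : Fin 3, (r : ℤ) ≤ |y i - (Pi.single 0 ((j + 1 : ℕ) : ℤ) : Site 3) i|)
    (hpath : PathIn (openGraph (ω ∩ (zdGraph 3).edgeSet)) {x : Site 3 | 0 ≤ x 0}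
      (Pi.single 0 ((j + 1 : ℕ) : ℤ)) y) :
    ∃ y' : Site 3, (∃ i : Fin 3, (r : ℤ) ≤ |y' i - (Pi.single 0 ((j + 1 : ℕ) : ℤ) : Site 3) i|) ∧
      PathIn (openGraph (ω ∩ (zdGraph 3).edgeSet)) {x : Site 3 | 1 ≤ x 0}
        (Pi.single 0 ((j + 1 : ℕ) : ℤ)) y' := by
  have hs : 1 ≤ (Pi.single 0 ((j + 1 : ℕ) : ℤ) : Site 3) 0 := by
    rw [Pi.single_eq_same]; push_cast; omega
  have hP := pathIn_upper hclosed hs hpath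
  have hyH : 0 ≤ y 0 := hpath.right_mem
  by_cases hy1 : 1 ≤ y 0
  · exact ⟨y, hy, hP.1 hy1⟩
  · have hy0 : y 0 = 0 := by omega
    refine ⟨y + Pi.single 0 1, ?_, hP.2 hy0⟩
    obtain ⟨i, hi⟩ := hy
    by_cases hi0 : i = 0
    · subst hi0
      refine ⟨0, ?_⟩
      rw [Pi.single_eq_same, hy0] at hi
      rw [Pi.add_apply, Pi.single_eq_same, Pi.single_eq_same, hy0]
      push_cast at hi ⊢
      rw [le_abs] at hi ⊢
      omega
    · refine ⟨i, ?_⟩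
      rwa [Pi.add_apply, Pi.single_eq_of_ne hi0, add_zero]

/-- The downward shift `x ↦ x - e₀` maps the strict upper region `{x₀ ≥ 1}` into `H = {x₀ ≥ 0}`.
[folklore] -/
theorem add_neg_single_mem_halfSpace {a : Site 3} (ha : a ∈ {x : Site 3 | 1 ≤ x 0}) :
    a + -(Pi.single 0 1 : Site 3) ∈ {x : Site 3 | 0 ≤ x 0} := by
  simp only [Set.mem_setOf_eq, Pi.add_apply, Pi.neg_apply, Pi.single_eq_same] at ha ⊢
  omega

/-- **`armFrom r (j+1) ⊆ (ω ↦ ω - e₀) ⁻¹' armFrom r j` on the configurations with all floor edges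
closed** (`j + 1 ≠ r`): by the surgery `ω` has an open walk inside `{x₀ ≥ 1}` from `(j+1)·e₀`
to a far point, and shifting down by `e₀` (`DCT16.pathIn_map`, `FloorDepthMono.adj_shift_iff`)
turns it into an open `H`-walk of `(ω - e₀) ∩ E(ℤ³)` from `j·e₀` to a point at the same
sup-distance. [folklore] -/
theorem mem_preimage_shiftDown {r j : ℕ} (hjr : j + 1 ≠ r) {ω : BondConfig (Site 3)}
    (hclosed : ∀ e ∈ floorEdgeSet 3, e ∉ ω) (hω : ω ∈ armFrom r (j + 1)) :
    ω ∈ BondConfig.relabel (sym2Equiv (Site.shift (-(Pi.single 0 1 : Site 3)))) ⁻¹'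
      armFrom r j := by
  obtain ⟨y, hy, hconn⟩ := hω
  rw [DCT16.mem_openConnIn_iff_pathIn] at hconn
  obtain ⟨y', ⟨i, hi⟩, hpath⟩ := exists_far_pathIn_upper hjr hclosed hy hconn
  have hstart : (Pi.single 0 ((j + 1 : ℕ) : ℤ) : Site 3) + -(Pi.single 0 1 : Site 3) =
      Pi.single 0 (j : ℤ) := by
    rw [← FloorDepthMono.start_add_single j, add_neg_cancel_right]
  rw [Set.mem_preimage, mem_armFrom, ← hstart]
  refine ⟨y' + -(Pi.single 0 1 : Site 3), ⟨i, ?_⟩, ?_⟩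
  · rwa [Pi.add_apply, Pi.add_apply, add_sub_add_right_eq_sub]
  · rw [DCT16.mem_openConnIn_iff_pathIn]
    exact DCT16.pathIn_map (fun z => z + -(Pi.single 0 1 : Site 3)) (B := {x : Site 3 | 0 ≤ x 0})
      (fun a ha => add_neg_single_mem_halfSpace ha)
      (fun a b _ _ hab => (FloorDepthMono.adj_shift_iff (-(Pi.single 0 1 : Site 3)) ω a b).2 hab)
      hpath

end FloorSuccZero

open FloorNoFloor FloorSuccZero in
/-- **Exactness certificate, part 1, of line `microscopic-floor-doubling-gain`.** With the floor
deleted (`s = 0`), `f_{j+1}(0) = γ_r(j)` for all `r, j` with `j + 1 ≠ r`: under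
`P^{ℍ}_{p_c,0}` almost surely all floor edges are closed, and then the depth-`(j+1)` arm event
coincides with `E₁ = (ω ↦ ω - e₀) ⁻¹' armFrom r j` (the arm from `(j+1)·e₀` inside `{x₀ ≥ 1}`:
walk surgery at the pendant floor vertices, `FloorSuccZero.mem_preimage_shiftDown`, and
`FloorNoFloor.preimage_shiftDown_subset_armFrom`), whose `P^{ℍ}_{p_c,0}`-probability is
`P_{p_c}(E₁) = γ_r(j)` (`FloorNoFloor.floorDilutedPercolation_zero_real_eq`, translation
invariance `FloorNoFloor.real_preimage_shiftDown`). [folklore] -/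
theorem armProbFloor_succ_zero : ∀ r j : ℕ, j + 1 ≠ r → armProbFloor r (j + 1) 0 = gammaR r j := by
  intro r j hjr
  unfold gammaR armProbFloor
  rw [← real_preimage_shiftDown (criticalProbI 3) r j,
    ← floorDilutedPercolation_zero_real_eq (criticalProbI 3) (determinedBy_preimage_shiftDown r j)
      (measurableSet_preimage_shiftDown r j)]
  refine measureReal_congr (Filter.eventuallyEq_set.2 ?_)
  filter_upwards [ae_floor_closed (criticalProbI 3)] with ω hω
  exact ⟨mem_preimage_shiftDown hjr hω, fun h => preimage_shiftDown_subset_armFrom r j h⟩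

end Summit.CriticalPhenomena.PercolationContinuityZ3.Theorems

end
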